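import Summits.Ventures.DiscreteObjects.Hadamard.InvolutionDet
import Summits.Ventures.DiscreteObjects.Hadamard.GramTwoSquares

/-!
# Hadamard 668 census, family F12 — eigenspace folding of involutions: no fixed-point-free involution with `ε = +1` (kernel)

Framing: lottery ticket; floor = certified bounds/negative ranges.

Cell pub-namedobj (venture DiscreteObjects), target (H), hadamard gen 13.  Companion of `GramTwoSquares` (Raghavarao /
Geramita–Seberry: a rational `m × m` matrix `W` with `W Wᵀ = n·1` and `m ≡ 2 (mod 4)` forces `n = x² + y²`).

FOLDING.  Let `(π, κ, d, e)` be a signed-permutation automorphism of a Hadamard matrix `H` of order `n` with `π² = κ² = 1`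
and sign type `ε = +1` (`d (π i) = d i`, `e (κ j) = e j`), and let `P k i = [k = π i] d i`, `Q l j = [l = κ j] e j` be the signed
permutation matrices, so that `P H = H Q` (`sgnPerm_intertwine`) and `P² = Q² = 1`, `P = Pᵀ`.  `H` maps the `+1`-eigenspace of
`Q` onto that of `P`.  With `U` = the matrix of pair vectors `e_k + d_k e_{πk}` over row representatives (`U P = U`,
`U Uᵀ = 2·1`: `pair_mul_sgnPerm`, `pair_mul_transpose`) and `V` = an integer matrix with `Vᵀ V = 1 + Q` (for fixed-point-free
`κ`: the column pair vectors, `transpose_pair_mul`), the integer matrix `T = U H Vᵀ` satisfies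
**`T Tᵀ = 4n·1`** (`folding_gram`: `U H (1 + Q) Hᵀ Uᵀ = U (n + n P) Uᵀ = 4n`), so `W = T/2` is a rational square matrix (after
reindexing) with `W Wᵀ = n·1` on `dim E₊(P)` coordinates (`folding_two_squares`).
CONSEQUENCE (`no_fpf_involution_pos`, general): **a Hadamard matrix of order `n ≡ 4 (mod 8)` with `n` not a sum of two squares
has NO signed involutory automorphism that is fixed-point-free on rows and columns with `ε = +1`** (`dim E₊ = n/2 ≡ 2 (mod 4)`).
The `H(668)` consequences (type III of the involution census of `InvolutionCensus668` occurs only with `ε = −1`, i.e.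
'nega' involutions `P² = −I` as for `g^167` of an order-334 automorphism; no permutation (unsigned) automorphism of `H(668)`
is a fixed-point-free involution on rows and columns; type II is empty) are drawn in the companion `InvolutionTypeII`.
Sanity check outside the kernel: for the Paley
`H(12)` (`12 ≡ 4 (mod 8)`, not a sum of two squares) an exhaustive count finds `0` automorphisms with `P` a fixed-point-free
involution and `ε = +1`, `792` with `ε = −1`, `990` of type I with `f = 4`, none with `f = 8, 10`
(HOME `pub-namedobj-hadamard-g13/code/h12_involution_check.py`).  Ours; no `sorry`.
-/

namespace Summit.Ventures.DiscreteObjects.Hadamard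

open Finset BigOperators Matrix

open Literature.Combinatorics.Designs.GoethalsSeidel (IsHadamardMatrix)

section algebra
variable {ι α β : Type*} [Fintype ι] [DecidableEq ι] [Fintype α] [DecidableEq α] [Fintype β] [DecidableEq β]

omit [Fintype α] [DecidableEq β] in
/-- **Folding identity.**  `H Hᵀ = n`, `P H = H Q`, `Vᵀ V = 1 + Q`, `U P = U`, `U Uᵀ = 2` ⇒ `(U H Vᵀ)(U H Vᵀ)ᵀ = 4n`. -/
theorem folding_gram (Hq P Q : Matrix ι ι ℚ) (U : Matrix α ι ℚ) (V : Matrix β ι ℚ) (n : ℚ)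
    (hH : Hq * Hqᵀ = n • (1 : Matrix ι ι ℚ)) (hPQ : P * Hq = Hq * Q) (hV : Vᵀ * V = 1 + Q)
    (hUP : U * P = U) (hU : U * Uᵀ = (2 : ℚ) • (1 : Matrix α α ℚ)) :
    (U * Hq * Vᵀ) * (U * Hq * Vᵀ)ᵀ = (4 * n) • (1 : Matrix α α ℚ) := by
  have h1 : (U * Hq * Vᵀ)ᵀ = V * (Hqᵀ * Uᵀ) := by
    rw [transpose_mul, transpose_mul, transpose_transpose]
  rw [h1]
  calc U * Hq * Vᵀ * (V * (Hqᵀ * Uᵀ)) = U * (Hq * (Vᵀ * V) * Hqᵀ) * Uᵀ := by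
        simp only [Matrix.mul_assoc]
    _ = U * (Hq * Hqᵀ + Hq * Q * Hqᵀ) * Uᵀ := by rw [hV, Matrix.mul_add, Matrix.mul_one, Matrix.add_mul]
    _ = U * (n • (1 : Matrix ι ι ℚ) + P * (n • (1 : Matrix ι ι ℚ))) * Uᵀ := by
        rw [← hPQ, Matrix.mul_assoc P, hH]
    _ = n • (U * Uᵀ + U * P * Uᵀ) := by
        rw [Matrix.mul_smul, Matrix.mul_one, ← smul_add, Matrix.mul_smul, Matrix.smul_mul, Matrix.mul_add,
          Matrix.mul_one, Matrix.add_mul]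
    _ = (4 * n) • (1 : Matrix α α ℚ) := by
        rw [hUP, hU, ← add_smul, smul_smul]
        norm_num
        rw [mul_comm]

omit [DecidableEq β] in
/-- **Folding ⇒ two squares.**  Under the folding hypotheses, with `|β| = |α| ≡ 2 (mod 4)` and `n = N ∈ ℕ`, the number `N`
is a sum of two squares (`W = ½ · U H Vᵀ`, reindexed square, has `W Wᵀ = N·1`; then `GramTwoSquares`). -/
theorem folding_two_squares (Hq P Q : Matrix ι ι ℚ) (U : Matrix α ι ℚ) (V : Matrix β ι ℚ) (N : ℕ)
    (hH : Hq * Hqᵀ = (N : ℚ) • (1 : Matrix ι ι ℚ)) (hPQ : P * Hq = Hq * Q) (hV : Vᵀ * V = 1 + Q)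
    (hUP : U * P = U) (hU : U * Uᵀ = (2 : ℚ) • (1 : Matrix α α ℚ)) (eβα : β ≃ α)
    (hα : Fintype.card α % 4 = 2) : ∃ x y : ℕ, N = x ^ 2 + y ^ 2 := by
  have hT := folding_gram Hq P Q U V (N : ℚ) hH hPQ hV hUP hU
  set T : Matrix α β ℚ := U * Hq * Vᵀ with hTdef
  set W : Matrix α α ℚ := ((1 : ℚ) / 2) • T.submatrix id eβα.symm with hWdef
  have hW : W * Wᵀ = (N : ℚ) • (1 : Matrix α α ℚ) := by
    rw [hWdef, transpose_smul, Matrix.smul_mul, Matrix.mul_smul, smul_smul, transpose_submatrix,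
      submatrix_mul_equiv, submatrix_id_id, hT, smul_smul]
    congr 1
    ring
  obtain ⟨u, v, huv⟩ := sq_add_sq_of_mul_transpose_self W (N : ℚ) hW hα
  exact nat_eq_sq_add_sq_of_rat huv

end algebra

section specs
variable {ι : Type*} [Fintype ι] [DecidableEq ι]

/-- **`P H = H Q`** for the signed permutation matrices of a signed automorphism with `π² = 1`. -/
theorem sgnPerm_intertwine {H : Matrix ι ι ℤ} {π κ : Equiv.Perm ι} {d e : ι → ℤ} (haut : IsSignedAut H π κ d e)
    (hπinv : ∀ i, π (π i) = i) (P Q : Matrix ι ι ℚ) (hP : ∀ k i, P k i = if k = π i then (d i : ℚ) else 0)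
    (hQ : ∀ l j, Q l j = if l = κ j then (e j : ℚ) else 0) :
    P * H.map (Int.castRingHom ℚ) = H.map (Int.castRingHom ℚ) * Q := by
  ext k j
  have he := haut.2.1
  have hA := haut.2.2
  rw [Matrix.mul_apply, Matrix.mul_apply]
  have hl : ∑ i, P k i * (H.map (Int.castRingHom ℚ)) i j = (d (π k) : ℚ) * H (π k) j := by
    rw [Finset.sum_eq_single (π k)]
    · simp [hP, hπinv]
    · intro i _ hi
      have : k ≠ π i := fun h => hi (by rw [h, hπinv])
      rw [hP, if_neg this, zero_mul]
    · intro h; exact absurd (Finset.mem_univ _) h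
  have hr : ∑ l, (H.map (Int.castRingHom ℚ)) k l * Q l j = (H k (κ j) : ℚ) * e j := by
    rw [Finset.sum_eq_single (κ j)]
    · simp [hQ]
    · intro l _ hl
      rw [hQ, if_neg hl, mul_zero]
    · intro h; exact absurd (Finset.mem_univ _) h
  rw [hl, hr]
  have h1 := hA (π k) j
  rw [hπinv] at h1
  have h1q : (H k (κ j) : ℚ) = (d (π k) : ℚ) * e j * H (π k) j := by exact_mod_cast h1
  have hee : (e j : ℚ) * e j = 1 := by exact_mod_cast pm_mul_self (he j)
  rw [h1q]
  linear_combination (-(d (π k) : ℚ) * (H (π k) j : ℚ)) * hee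

/-- **`U P = U`**: the pair vectors `e_{r c} + d_{r c} e_{π r c}` are fixed by `P` when `ε = +1`. -/
theorem pair_mul_sgnPerm {α : Type*} (π : Equiv.Perm ι) (d : ι → ℤ) (hπinv : ∀ i, π (π i) = i)
    (hd : ∀ i, d i = 1 ∨ d i = -1) (hε : ∀ i, d (π i) = d i) (r : α → ι) (hfix : ∀ c, π (r c) ≠ r c)
    (U : Matrix α ι ℚ) (hU : ∀ c i, U c i = if i = r c then 1 else if i = π (r c) then (d (r c) : ℚ) else 0)
    (P : Matrix ι ι ℚ) (hP : ∀ k i, P k i = if k = π i then (d i : ℚ) else 0) : U * P = U := by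
  ext c i
  rw [Matrix.mul_apply, Finset.sum_eq_single (π i)]
  · rw [hP, if_pos rfl, hU c (π i), hU c i]
    by_cases h1 : i = r c
    · subst h1
      have hne : π (r c) ≠ r c := hfix c
      rw [if_neg hne, if_pos rfl, if_pos rfl]
      exact_mod_cast pm_mul_self (hd (r c))
    · by_cases h2 : i = π (r c)
      · subst h2
        rw [hπinv, if_pos rfl, if_neg (hfix c), if_pos rfl, hε, one_mul]
      · have h3 : π i ≠ r c := fun h => h2 (by rw [← h, hπinv])
        have h4 : π i ≠ π (r c) := fun h => h1 (π.injective h)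
        rw [if_neg h3, if_neg h4, if_neg h1, if_neg h2, zero_mul]
  · intro k _ hk
    rw [hP, if_neg hk, mul_zero]
  · intro h; exact absurd (Finset.mem_univ _) h

/-- **`U Uᵀ = 2·1`**: pair vectors over separated representatives are orthogonal of norm `2`. -/
theorem pair_mul_transpose {α : Type*} [Fintype α] [DecidableEq α] (π : Equiv.Perm ι) (d : ι → ℤ)
    (hd : ∀ i, d i = 1 ∨ d i = -1) (r : α → ι) (hsep : ∀ c c', r c ≠ π (r c')) (hinj : Function.Injective r)
    (U : Matrix α ι ℚ) (hU : ∀ c i, U c i = if i = r c then 1 else if i = π (r c) then (d (r c) : ℚ) else 0) :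
    U * Uᵀ = (2 : ℚ) • (1 : Matrix α α ℚ) := by
  ext c c'
  rw [Matrix.mul_apply, Matrix.smul_apply, Matrix.one_apply]
  simp only [transpose_apply]
  have hne : r c ≠ π (r c) := hsep c c
  rw [Finset.sum_eq_add_of_mem (r c) (π (r c)) (Finset.mem_univ _) (Finset.mem_univ _) hne]
  · rw [hU c (r c), if_pos rfl, hU c (π (r c)), if_neg (Ne.symm hne), if_pos rfl]
    by_cases h : c = c'
    · subst h
      rw [hU c (r c), if_pos rfl, hU c (π (r c)), if_neg (Ne.symm hne), if_pos rfl, if_pos rfl, smul_eq_mul]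
      have : (d (r c) : ℚ) * d (r c) = 1 := by exact_mod_cast pm_mul_self (hd (r c))
      linear_combination this
    · have h1 : r c ≠ r c' := fun hh => h (hinj hh)
      have h2 : r c ≠ π (r c') := hsep c c'
      have h3 : π (r c) ≠ r c' := fun hh => hsep c' c hh.symm
      have h4 : π (r c) ≠ π (r c') := fun hh => h1 (π.injective hh)
      rw [hU c' (r c), if_neg h1, if_neg h2, hU c' (π (r c)), if_neg h3, if_neg h4, if_neg h]
      simp
  · intro i _ hi
    rw [hU c i, if_neg hi.1, if_neg hi.2, zero_mul]

omit [Fintype ι] in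
/-- **`Vᵀ V = 1 + Q − F`**: the column pair vectors `e_{r c} + e_{r c} e_{κ r c}` over representatives covering all moved
columns resolve `1 + Q` off the fixed columns; `F` is the diagonal `1 + e_l` on the fixed columns `l`. -/
theorem transpose_pair_mul {β : Type*} [Fintype β] (κ : Equiv.Perm ι) (e : ι → ℤ) (hκinv : ∀ j, κ (κ j) = j)
    (he : ∀ j, e j = 1 ∨ e j = -1) (hεe : ∀ j, e (κ j) = e j) (r : β → ι) (hsep : ∀ c c', r c ≠ κ (r c'))
    (hinj : Function.Injective r) (hcov : ∀ l, κ l ≠ l → ∃ c, l = r c ∨ l = κ (r c))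
    (V : Matrix β ι ℚ) (hV : ∀ c l, V c l = if l = r c then 1 else if l = κ (r c) then (e (r c) : ℚ) else 0)
    (Q : Matrix ι ι ℚ) (hQ : ∀ l j, Q l j = if l = κ j then (e j : ℚ) else 0)
    (F : Matrix ι ι ℚ) (hF : ∀ l l', F l l' = if l = l' ∧ κ l = l then 1 + (e l : ℚ) else 0) :
    Vᵀ * V = 1 + Q - F := by
  ext l l'
  rw [Matrix.mul_apply, Matrix.sub_apply, Matrix.add_apply, Matrix.one_apply, hQ, hF]
  simp only [transpose_apply]
  by_cases hl : κ l = l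
  · -- a fixed column meets no pair vector
    have h0 : ∀ c, V c l = 0 := by
      intro c
      have h1 : l ≠ r c := fun h => hsep c c (by rw [← h, hl])
      have h2 : l ≠ κ (r c) := by
        intro h
        have : κ l = r c := by rw [h, hκinv]
        exact h1 (by rw [← hl]; exact this)
      rw [hV, if_neg h1, if_neg h2]
    rw [Finset.sum_congr rfl fun c _ => by rw [h0 c, zero_mul], Finset.sum_const_zero]
    by_cases hll : l = l'
    · subst hll
      rw [if_pos rfl, if_pos hl.symm, if_pos ⟨rfl, hl⟩]
      ring
    · have h2 : l ≠ κ l' := fun h => hll (by rw [← hl, h, hκinv])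
      rw [if_neg hll, if_neg h2, if_neg (fun h => hll h.1)]
      ring
  · obtain ⟨c₀, hc₀⟩ := hcov l hl
    have hF0 : (if l = l' ∧ κ l = l then 1 + (e l : ℚ) else 0) = 0 := if_neg (fun h => hl h.2)
    rw [hF0, sub_zero]
    -- only the class `c₀` contributes
    rw [Finset.sum_eq_single c₀]
    · rcases hc₀ with h0 | h0
      · -- `l` is the representative
        have hV0 : V c₀ l = 1 := by rw [hV, if_pos h0]
        rw [hV0, one_mul, hV c₀ l']
        by_cases h1 : l' = r c₀
        · rw [if_pos h1, if_pos (h0.trans h1.symm)]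
          have : l ≠ κ l' := by rw [h1, h0]; exact hsep c₀ c₀
          rw [if_neg this, add_zero]
        · rw [if_neg h1]
          by_cases h2 : l' = κ (r c₀)
          · rw [if_pos h2]
            have hll : l ≠ l' := by rw [h0, h2]; exact hsep c₀ c₀
            have hlk : l = κ l' := by rw [h2, hκinv, h0]
            rw [if_neg hll, if_pos hlk, zero_add, h2, hεe]
          · rw [if_neg h2]
            have hll : l ≠ l' := fun h => h1 (h ▸ h0)
            have hlk : l ≠ κ l' := fun h => h2 (by rw [← hκinv l', ← h, h0])
            rw [if_neg hll, if_neg hlk, add_zero]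
      · -- `l` is the partner of the representative
        have hV0 : V c₀ l = (e (r c₀) : ℚ) := by
          rw [hV, if_neg (by rw [h0]; exact (hsep c₀ c₀).symm), if_pos h0]
        rw [hV0, hV c₀ l']
        have hee : (e (r c₀) : ℚ) * e (r c₀) = 1 := by exact_mod_cast pm_mul_self (he (r c₀))
        by_cases h1 : l' = r c₀
        · rw [if_pos h1]
          have hll : l ≠ l' := by rw [h0, h1]; exact (hsep c₀ c₀).symm
          have hlk : l = κ l' := by rw [h1, h0]
          rw [if_neg hll, if_pos hlk, h1, zero_add, mul_one]
        · rw [if_neg h1]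
          by_cases h2 : l' = κ (r c₀)
          · rw [if_pos h2, if_pos (h0.trans h2.symm)]
            have : l ≠ κ l' := by rw [h2, hκinv, h0]; exact (hsep c₀ c₀).symm
            rw [if_neg this, add_zero, hee]
          · rw [if_neg h2, mul_zero]
            have hll : l ≠ l' := fun h => h2 (h ▸ h0)
            have hlk : l ≠ κ l' := by
              intro h
              apply h1
              have := congrArg κ h
              rw [hκinv, h0, hκinv] at this
              exact this.symm
            rw [if_neg hll, if_neg hlk, add_zero]
    · intro c _ hc
      have h1 : l ≠ r c := by
        rcases hc₀ with h0 | h0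
        · intro h; exact hc (hinj (h.symm.trans h0).symm).symm
        · intro h; exact hsep c c₀ (h.symm.trans h0)
      have h2 : l ≠ κ (r c) := by
        rcases hc₀ with h0 | h0
        · intro h; exact hsep c₀ c (h0.symm.trans h)
        · intro h
          have : r c₀ = r c := κ.injective (h0.symm.trans h)
          exact hc (hinj this).symm
      rw [hV c l, if_neg h1, if_neg h2, zero_mul]
    · intro h; exact absurd (Finset.mem_univ _) h

end specs

section fpf
variable {ι : Type*} [Fintype ι] [DecidableEq ι]

/-- **No fixed-point-free involution with `ε = +1`** (ordered index type).  For a Hadamard matrix of order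
`n ≡ 4 (mod 8)` that is not a sum of two squares, no signed automorphism `(π, κ, d, e)` has `π, κ` fixed-point-free
involutions with `d (π i) = d i` for all `i`. -/
theorem no_fpf_involution_pos_ord [LinearOrder ι] {H : Matrix ι ι ℤ} {π κ : Equiv.Perm ι} {d e : ι → ℤ}
    (hH : IsHadamardMatrix H) (hn8 : Fintype.card ι % 8 = 4) (hns : ¬ ∃ x y : ℕ, Fintype.card ι = x ^ 2 + y ^ 2)
    (haut : IsSignedAut H π κ d e) (hπinv : ∀ i, π (π i) = i) (hκinv : ∀ j, κ (κ j) = j)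
    (hπf : ∀ i, π i ≠ i) (hκf : ∀ j, κ j ≠ j) (hε : ∀ i, d (π i) = d i) : False := by
  have hd := haut.1
  have he := haut.2.1
  -- column signs also have `ε = +1`
  have hεe : ∀ j, e (κ j) = e j := by
    intro j
    obtain ⟨i⟩ : Nonempty ι := Fintype.card_pos_iff.mp (by omega)
    have h := signedAut_sq_sign hH.1 haut hπinv hκinv i j
    rw [hε i, pm_mul_self (hd i), one_mul] at h
    exact (pm_eq_of_mul_eq_one (he j) (he (κ j)) h).symm
  -- representatives of row pairs and column pairs
  set R := univ.filter (fun k => π k ≠ k ∧ k < π k) with hRdef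
  set C := univ.filter (fun j => κ j ≠ j ∧ j < κ j) with hCdef
  have h2R : 2 * R.card = Fintype.card ι := by
    rw [two_mul_card_reps π hπinv]
    have : (univ.filter fun i => π i ≠ i) = univ := by
      ext i; simp [hπf i]
    rw [this, Finset.card_univ]
  have h2C : 2 * C.card = Fintype.card ι := by
    rw [two_mul_card_reps κ hκinv]
    have : (univ.filter fun j => κ j ≠ j) = univ := by
      ext j; simp [hκf j]
    rw [this, Finset.card_univ]
  have hcardCR : Fintype.card {j // j ∈ C} = Fintype.card {k // k ∈ R} := by
    rw [Fintype.card_coe, Fintype.card_coe]; omega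
  obtain ⟨eCR⟩ : Nonempty ({j // j ∈ C} ≃ {k // k ∈ R}) := Fintype.card_eq.mp hcardCR
  have hRmod : Fintype.card {k // k ∈ R} % 4 = 2 := by rw [Fintype.card_coe]; omega
  -- separation / injectivity / covering of representatives
  have hsepR : ∀ c c' : {k // k ∈ R}, c.1 ≠ π c'.1 := by
    intro c c' h
    have hc := (Finset.mem_filter.mp c.2).2
    have hc' := (Finset.mem_filter.mp c'.2).2
    have h1 : π c.1 = c'.1 := by rw [h, hπinv]
    have := hc.2; rw [h1] at this
    have := hc'.2; rw [← h] at this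
    exact lt_asymm ‹c.1 < c'.1› ‹c'.1 < c.1›
  have hsepC : ∀ c c' : {j // j ∈ C}, c.1 ≠ κ c'.1 := by
    intro c c' h
    have hc := (Finset.mem_filter.mp c.2).2
    have hc' := (Finset.mem_filter.mp c'.2).2
    have h1 : κ c.1 = c'.1 := by rw [h, hκinv]
    have := hc.2; rw [h1] at this
    have := hc'.2; rw [← h] at this
    exact lt_asymm ‹c.1 < c'.1› ‹c'.1 < c.1›
  have hcovC : ∀ l, κ l ≠ l → ∃ c : {j // j ∈ C}, l = c.1 ∨ l = κ c.1 := by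
    intro l hl
    rcases lt_or_gt_of_ne hl with h | h
    · refine ⟨⟨κ l, Finset.mem_filter.mpr ⟨Finset.mem_univ _, ?_, ?_⟩⟩, Or.inr (hκinv l).symm⟩
      · rw [hκinv]; exact Ne.symm hl
      · rw [hκinv]; exact h
    · exact ⟨⟨l, Finset.mem_filter.mpr ⟨Finset.mem_univ _, hl, h⟩⟩, Or.inl rfl⟩
  -- the matrices
  set Hq : Matrix ι ι ℚ := H.map (Int.castRingHom ℚ) with hHqdef
  set P : Matrix ι ι ℚ := fun k i => if k = π i then (d i : ℚ) else 0 with hPdef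
  set Q : Matrix ι ι ℚ := fun l j => if l = κ j then (e j : ℚ) else 0 with hQdef
  set U : Matrix {k // k ∈ R} ι ℚ :=
    fun c i => if i = c.1 then 1 else if i = π c.1 then (d c.1 : ℚ) else 0 with hUdef
  set V : Matrix {j // j ∈ C} ι ℚ :=
    fun c l => if l = c.1 then 1 else if l = κ c.1 then (e c.1 : ℚ) else 0 with hVdef
  set F : Matrix ι ι ℚ := fun l l' => if l = l' ∧ κ l = l then 1 + (e l : ℚ) else 0 with hFdef
  have hHq : Hq * Hqᵀ = ((Fintype.card ι : ℕ) : ℚ) • (1 : Matrix ι ι ℚ) := by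
    have h1 : Hq * Hqᵀ = (H * Hᵀ).map (Int.castRingHom ℚ) := by
      rw [Matrix.map_mul, hHqdef, transpose_map]
    rw [h1, hH.2]
    ext i j
    rw [Matrix.map_apply, Matrix.smul_apply, Matrix.smul_apply, Matrix.one_apply, Matrix.one_apply]
    split_ifs <;> simp
  have hPQ : P * Hq = Hq * Q :=
    sgnPerm_intertwine haut hπinv P Q (fun _ _ => rfl) (fun _ _ => rfl)
  have hUP : U * P = U :=
    pair_mul_sgnPerm π d hπinv hd hε (fun c : {k // k ∈ R} => c.1)
      (fun c => (Finset.mem_filter.mp c.2).2.1) U (fun _ _ => rfl) P (fun _ _ => rfl)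
  have hUU : U * Uᵀ = (2 : ℚ) • 1 :=
    pair_mul_transpose π d hd (fun c : {k // k ∈ R} => c.1) hsepR
      (fun c c' h => Subtype.ext h) U (fun _ _ => rfl)
  have hVV : Vᵀ * V = 1 + Q - F :=
    transpose_pair_mul κ e hκinv he hεe (fun c : {j // j ∈ C} => c.1) hsepC (fun c c' h => Subtype.ext h)
      hcovC V (fun _ _ => rfl) Q (fun _ _ => rfl) F (fun _ _ => rfl)
  have hF0 : F = 0 := by
    ext l l'
    rw [hFdef]
    simp [hκf l]
  rw [hF0, sub_zero] at hVV
  obtain ⟨x, y, hxy⟩ := folding_two_squares Hq P Q U V (Fintype.card ι) hHq hPQ hVV hUP hUU eCR hRmod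
  exact hns ⟨x, y, hxy⟩

/-- **No fixed-point-free involution with `ε = +1`.**  A Hadamard matrix of order `n ≡ 4 (mod 8)`, `n` not a sum of two
squares, has no signed automorphism `(π, κ, d, e)` with `π, κ` fixed-point-free involutions and `d ∘ π = d`
(equivalently `P² = +I` for the signed permutation matrix `P`). -/
theorem no_fpf_involution_pos {H : Matrix ι ι ℤ} {π κ : Equiv.Perm ι} {d e : ι → ℤ}
    (hH : IsHadamardMatrix H) (hn8 : Fintype.card ι % 8 = 4) (hns : ¬ ∃ x y : ℕ, Fintype.card ι = x ^ 2 + y ^ 2)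
    (haut : IsSignedAut H π κ d e) (hπinv : ∀ i, π (π i) = i) (hκinv : ∀ j, κ (κ j) = j)
    (hπf : ∀ i, π i ≠ i) (hκf : ∀ j, κ j ≠ j) (hε : ∀ i, d (π i) = d i) : False := by
  classical
  letI : LinearOrder ι := LinearOrder.lift' (Fintype.equivFin ι) (Fintype.equivFin ι).injective
  exact no_fpf_involution_pos_ord hH hn8 hns haut hπinv hκinv hπf hκf hε

end fpf

end Summit.Ventures.DiscreteObjects.Hadamard
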